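import Summits.SmoothPoincare4.SmoothPoincare4.Theses.EntropyRung
import Mathlib.Analysis.SpecialFunctions.SmoothTransition
import Mathlib.Analysis.Calculus.ContDiff.Deriv
import Mathlib.Analysis.Calculus.Deriv.Slope
import Mathlib.Analysis.Calculus.Deriv.MeanValue
import Mathlib.MeasureTheory.Integral.IntervalIntegral.FundThmCalculus
import HarnessLib

/-!
# The round cap profile (stub `roundProfile_exists`, line `green-blowup-conformal-entropy`,
crux `EntropyRung.SubcylindricalExistence`, item stmt-SmoothPoincare4-10871)

Helper H9 for Stub D (`stub_conformalGluing`): a smooth, nondecreasing, concave, eventually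
constant function `θ : ℝ → ℝ` with `θ 0 ≥ 0` which coincides with the ROUND profile
`θ₀(s) = 4Ks/(4K+s)` on `[s₀, K²]` (so that `θ₀(G)² g = (1 + G/4K)⁻² G² g` is a round cap of the
blow-up `G² g`), stays below `4K` on `[s₀, ∞)`, above `θ₀(K²)` on `[K², ∞)`, and has
`θ' ≤ θ₀'` on `[s₀, ∞)`.

Construction (derivative level, pure one-variable calculus). With `ST = Real.smoothTransition`:
* a smooth monotone lower clamp `m` (`m = id` on `[s₀, ∞)`, `m ≥ s₀/2`), a primitive of
  `ST((t - s₀/2)/(s₀/2))`;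
* the clamped slope `A = θ₀' ∘ m = 16K²/(4K+m)²` (smooth, antitone, `= θ₀'` on `[s₀, ∞)`);
* the upper cut-off `H(s) = ST((s - K²)/K²)` and the slope `d = A · (1 - H)` (smooth, antitone,
  nonnegative, `= θ₀'` on `[s₀, K²]`, `= 0` on `[2K², ∞)`);
* `θ(s) = θ₀(s₀) + ∫_{s₀}^{s} d`, `S = 2K²`; `θ' = d` by the fundamental theorem of calculus,
  `θ'' = d' ≤ 0` by antitonicity, `θ = θ₀` on `[s₀, K²]` by FTC-2 for `θ₀`, and
  `θ(0) ≥ θ₀(s₀) - s₀ θ₀'(s₀/2) ≥ 0` (equivalent to `s₀²/4 ≥ 0`).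
No manifolds here; all functions are introduced existentially (no definitions).
-/

noncomputable section

-- the registered namespace `Summit.SmoothPoincare4.SmoothPoincare4.Theorems` repeats a component
set_option linter.dupNamespace false

open scoped ContDiff Topology
open Set Filter MeasureTheory

namespace Summit.SmoothPoincare4.SmoothPoincare4.Theorems

namespace RoundProfile

/-! ### Primitives of smooth functions -/

/-- FTC-1: `x ↦ c + ∫_a^x f` has derivative `f s` at `s` for continuous `f`. -/
theorem hasDerivAt_const_add_integral {f : ℝ → ℝ} (hf : Continuous f) (a c s : ℝ) :
    HasDerivAt (fun x ↦ c + ∫ t in a..x, f t) (f s) s :=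
  (hf.integral_hasStrictDerivAt a s).hasDerivAt.const_add c

/-- The derivative of `x ↦ c + ∫_a^x f` is `f` (continuous `f`). -/
theorem deriv_const_add_integral {f : ℝ → ℝ} (hf : Continuous f) (a c : ℝ) :
    deriv (fun x ↦ c + ∫ t in a..x, f t) = f :=
  funext fun s ↦ (hasDerivAt_const_add_integral hf a c s).deriv

/-- A primitive of a smooth function is smooth. -/
theorem contDiff_const_add_integral {f : ℝ → ℝ} (hf : ContDiff ℝ ∞ f) (a c : ℝ) :
    ContDiff ℝ ∞ (fun x ↦ c + ∫ t in a..x, f t) :=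
  contDiff_infty_iff_deriv.2
    ⟨fun s ↦ (hasDerivAt_const_add_integral hf.continuous a c s).differentiableAt,
      by rw [deriv_const_add_integral hf.continuous]; exact hf⟩

/-- Increment of a primitive: `F b = F a + ∫_a^b f`. -/
theorem const_add_integral_eq {f : ℝ → ℝ} (hf : Continuous f) (a c x y : ℝ) :
    (c + ∫ t in a..y, f t) = (c + ∫ t in a..x, f t) + ∫ t in x..y, f t := by
  rw [add_assoc, intervalIntegral.integral_add_adjacent_intervals (hf.intervalIntegrable _ _)
    (hf.intervalIntegrable _ _)]

/-! ### The lower clamp, the clamped slope and the cut-off -/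

/-- A smooth monotone lower clamp: `m = id` on `[s₀, ∞)` and `m ≥ s₀/2` everywhere
(a primitive of the smooth step `ST((t - s₀/2)/(s₀/2))`). -/
theorem exists_clamp {s₀ : ℝ} (hs₀ : 0 < s₀) : ∃ m : ℝ → ℝ, ContDiff ℝ ∞ m ∧ Monotone m ∧
    (∀ s, s₀ ≤ s → m s = s) ∧ ∀ s, s₀ / 2 ≤ m s := by
  obtain ⟨f, hf_smooth, hf_nn, hf_le, hf_zero, hf_one⟩ : ∃ f : ℝ → ℝ, ContDiff ℝ ∞ f ∧
      (∀ t, 0 ≤ f t) ∧ (∀ t, f t ≤ 1) ∧ (∀ t, t ≤ s₀ / 2 → f t = 0) ∧ ∀ t, s₀ ≤ t → f t = 1 := by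
    refine ⟨fun t ↦ Real.smoothTransition ((t - s₀ / 2) / (s₀ / 2)),
      Real.smoothTransition.contDiff.comp ((contDiff_id.sub contDiff_const).div_const _),
      fun t ↦ Real.smoothTransition.nonneg _, fun t ↦ Real.smoothTransition.le_one _,
      fun t ht ↦ Real.smoothTransition.zero_of_nonpos
        (div_nonpos_of_nonpos_of_nonneg (by linarith) (by linarith)),
      fun t ht ↦ Real.smoothTransition.one_of_one_le ?_⟩
    rw [le_div_iff₀ (by linarith)]
    linarith
  have hf_cont : Continuous f := hf_smooth.continuous
  have hint : ∀ a b, IntervalIntegrable f volume a b := fun a b ↦ hf_cont.intervalIntegrable a b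
  refine ⟨fun s ↦ s₀ + ∫ t in s₀..s, f t, contDiff_const_add_integral hf_smooth _ _, ?_, ?_, ?_⟩
  · refine monotone_of_deriv_nonneg
      (fun s ↦ (hasDerivAt_const_add_integral hf_cont _ _ s).differentiableAt) fun s ↦ ?_
    rw [deriv_const_add_integral hf_cont]
    exact hf_nn s
  · intro s hs
    have h1 : ∫ t in s₀..s, f t = ∫ _ in s₀..s, (1 : ℝ) :=
      intervalIntegral.integral_congr fun t ht ↦ hf_one t (by rw [uIcc_of_le hs] at ht; exact ht.1)
    simp only [h1, intervalIntegral.integral_const, smul_eq_mul, mul_one]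
    ring
  · intro s
    show s₀ / 2 ≤ s₀ + ∫ t in s₀..s, f t
    rw [← intervalIntegral.integral_add_adjacent_intervals (hint s₀ (s₀ / 2)) (hint (s₀ / 2) s),
      intervalIntegral.integral_symm (s₀ / 2) s₀]
    have h1 : ∫ t in (s₀ / 2)..s₀, f t ≤ ∫ _ in (s₀ / 2)..s₀, (1 : ℝ) :=
      intervalIntegral.integral_mono_on (by linarith) (hint _ _) intervalIntegrable_const
        fun t _ ↦ hf_le t
    rw [intervalIntegral.integral_const, smul_eq_mul, mul_one] at h1
    have h2 : 0 ≤ ∫ t in (s₀ / 2)..s, f t := by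
      rcases le_or_gt (s₀ / 2) s with hs | hs
      · exact intervalIntegral.integral_nonneg hs fun t _ ↦ hf_nn t
      · rw [intervalIntegral.integral_symm, intervalIntegral.integral_congr (g := fun _ ↦ (0 : ℝ))
          fun t ht ↦ hf_zero t (by rw [uIcc_of_le hs.le] at ht; exact ht.2)]
        simp
    linarith

/-- The clamped round slope `A = θ₀' ∘ m = 16K²/(4K + m)²`: smooth, antitone, nonnegative,
equal to `θ₀'(s) = 16K²/(4K+s)²` for `s ≥ s₀` and bounded by `θ₀'(s₀/2)`. -/
theorem exists_clampedSlope {K s₀ : ℝ} (hK : 0 < K) (hs₀ : 0 < s₀) :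
    ∃ A : ℝ → ℝ, ContDiff ℝ ∞ A ∧ Antitone A ∧ (∀ s, 0 ≤ A s) ∧
      (∀ s, s₀ ≤ s → A s = 16 * K ^ 2 / (4 * K + s) ^ 2) ∧
      (∀ s, A s ≤ 16 * K ^ 2 / (4 * K + s₀ / 2) ^ 2) := by
  obtain ⟨m, hm_smooth, hm_mono, hm_id, hm_ge⟩ := exists_clamp hs₀
  have hpos : ∀ s, 0 < 4 * K + m s := fun s ↦ by linarith [hm_ge s]
  refine ⟨fun s ↦ 16 * K ^ 2 / (4 * K + m s) ^ 2, ?_, ?_, ?_, ?_, ?_⟩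
  · exact contDiff_const.fun_div ((contDiff_const.add hm_smooth).pow 2)
      fun s ↦ (pow_pos (hpos s) 2).ne'
  · intro s t hst
    apply div_le_div_of_nonneg_left (by positivity) (pow_pos (hpos s) 2)
    exact pow_le_pow_left₀ (hpos s).le (by linarith [hm_mono hst]) 2
  · intro s
    exact div_nonneg (by positivity) (sq_nonneg _)
  · intro s hs
    simp only [hm_id s hs]
  · intro s
    apply div_le_div_of_nonneg_left (by positivity) (by positivity)
    exact pow_le_pow_left₀ (by linarith) (by linarith [hm_ge s]) 2

/-- The upper cut-off `H(s) = ST((s - K²)/K²)`: smooth, monotone, `0` on `(-∞, K²]`, `1` on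
`[2K², ∞)`, with values in `[0, 1]`. -/
theorem exists_cutoff {K : ℝ} (hK : 0 < K) :
    ∃ H : ℝ → ℝ, ContDiff ℝ ∞ H ∧ Monotone H ∧ (∀ s, s ≤ K ^ 2 → H s = 0) ∧
      (∀ s, 2 * K ^ 2 ≤ s → H s = 1) ∧ (∀ s, 0 ≤ H s) ∧ (∀ s, H s ≤ 1) := by
  have hK2 : 0 < K ^ 2 := by positivity
  refine ⟨fun s ↦ Real.smoothTransition ((s - K ^ 2) / K ^ 2),
    Real.smoothTransition.contDiff.comp ((contDiff_id.sub contDiff_const).div_const _),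
    fun s t hst ↦ Real.smoothTransition.monotone (by gcongr),
    fun s hs ↦ Real.smoothTransition.zero_of_nonpos
      (div_nonpos_of_nonpos_of_nonneg (by linarith) hK2.le),
    fun s hs ↦ Real.smoothTransition.one_of_one_le ?_,
    fun s ↦ Real.smoothTransition.nonneg _, fun s ↦ Real.smoothTransition.le_one _⟩
  rw [le_div_iff₀ hK2]
  linarith

/-- The slope `d = A · (1 - H)` of the profile: smooth, antitone, nonnegative, equal to
`θ₀'` on `[s₀, K²]`, at most `θ₀'` on `[s₀, ∞)`, zero on `[2K², ∞)`, bounded by `θ₀'(s₀/2)`. -/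
theorem exists_slope {K s₀ : ℝ} (hK : 0 < K) (hs₀ : 0 < s₀) :
    ∃ d : ℝ → ℝ, ContDiff ℝ ∞ d ∧ Antitone d ∧ (∀ s, 0 ≤ d s) ∧
      (∀ s, s₀ ≤ s → s ≤ K ^ 2 → d s = 16 * K ^ 2 / (4 * K + s) ^ 2) ∧
      (∀ s, s₀ ≤ s → d s ≤ 16 * K ^ 2 / (4 * K + s) ^ 2) ∧
      (∀ s, 2 * K ^ 2 ≤ s → d s = 0) ∧
      (∀ s, d s ≤ 16 * K ^ 2 / (4 * K + s₀ / 2) ^ 2) := by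
  obtain ⟨A, hA_smooth, hA_anti, hA_nn, hA_eq, hA_le⟩ := exists_clampedSlope hK hs₀
  obtain ⟨H, hH_smooth, hH_mono, hH_zero, hH_one, hH_nn, hH_le⟩ := exists_cutoff hK
  refine ⟨fun s ↦ A s * (1 - H s), hA_smooth.mul (contDiff_const.sub hH_smooth),
    ?_, ?_, ?_, ?_, ?_, ?_⟩
  · intro s t hst
    exact mul_le_mul (hA_anti hst) (by linarith [hH_mono hst]) (by linarith [hH_le t]) (hA_nn s)
  · intro s
    exact mul_nonneg (hA_nn s) (by linarith [hH_le s])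
  · intro s hs hsK
    simp only [hA_eq s hs, hH_zero s hsK, sub_zero, mul_one]
  · intro s hs
    show A s * (1 - H s) ≤ _
    rw [← hA_eq s hs]
    exact mul_le_of_le_one_right (hA_nn s) (by linarith [hH_nn s])
  · intro s hs
    simp [hH_one s hs]
  · intro s
    calc A s * (1 - H s) ≤ A s := mul_le_of_le_one_right (hA_nn s) (by linarith [hH_nn s])
      _ ≤ _ := hA_le s

/-! ### The round profile `θ₀(s) = 4Ks/(4K+s)` -/

/-- `θ₀' (x) = 16K²/(4K+x)²` away from the pole `x = -4K`. -/
theorem hasDerivAt_roundProfile {K x : ℝ} (hx : 4 * K + x ≠ 0) :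
    HasDerivAt (fun s ↦ 4 * K * s / (4 * K + s)) (16 * K ^ 2 / (4 * K + x) ^ 2) x := by
  have h1 : HasDerivAt (fun s ↦ 4 * K * s) (4 * K * 1) x := (hasDerivAt_id' x).const_mul (4 * K)
  have h2 : HasDerivAt (fun s ↦ 4 * K + s) 1 x := (hasDerivAt_id' x).const_add (4 * K)
  refine (h1.fun_div h2 hx).congr_deriv ?_
  field_simp
  ring

/-- `θ₀'` is interval integrable on `[a, b] ⊆ [0, ∞)` (`K > 0`). -/
theorem intervalIntegrable_roundSlope {K a b : ℝ} (hK : 0 < K) (ha : 0 ≤ a) (hab : a ≤ b) :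
    IntervalIntegrable (fun x ↦ 16 * K ^ 2 / (4 * K + x) ^ 2) volume a b := by
  refine ContinuousOn.intervalIntegrable (continuousOn_const.div (by fun_prop) fun x hx ↦ ?_)
  rw [uIcc_of_le hab] at hx
  have : 0 < 4 * K + x := by linarith [hx.1]
  positivity

/-- FTC-2 for `θ₀` on `[s₀, s] ⊆ (0, ∞)`. -/
theorem integral_roundSlope {K s₀ s : ℝ} (hK : 0 < K) (hs₀ : 0 < s₀) (hs : s₀ ≤ s) :
    ∫ t in s₀..s, 16 * K ^ 2 / (4 * K + t) ^ 2 =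
      4 * K * s / (4 * K + s) - 4 * K * s₀ / (4 * K + s₀) := by
  apply intervalIntegral.integral_eq_sub_of_hasDerivAt
  · intro x hx
    rw [uIcc_of_le hs] at hx
    exact hasDerivAt_roundProfile (by linarith [hx.1])
  · exact intervalIntegrable_roundSlope hK hs₀.le hs

end RoundProfile

open RoundProfile in
/-- **The round cap profile** (helper H9 of line `green-blowup-conformal-entropy`): for
`0 < s₀ < K²` there is a smooth, nondecreasing, concave `θ : ℝ → ℝ` with `θ 0 ≥ 0`, constant on
`[S, ∞)` for some `S ≥ K²`, equal to the round profile `4Ks/(4K+s)` on `[s₀, K²]`, bounded by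
`4K` on `[s₀, ∞)`, at least `θ₀(K²)` on `[K², ∞)`, and with `θ' ≤ 16K²/(4K+s)²` on `[s₀, ∞)`.
Construction: `θ = θ₀(s₀) + ∫_{s₀} d` with the slope `d` of `RoundProfile.exists_slope`,
`S = 2K²`. -/
theorem roundProfile_exists :
    ∀ (K s₀ : ℝ), 0 < K → 0 < s₀ → s₀ < K ^ 2 →
      ∃ θ : ℝ → ℝ, ∃ S : ℝ, ContDiff ℝ ∞ θ ∧ (∀ s, 0 ≤ deriv θ s) ∧ (∀ s, deriv (deriv θ) s ≤ 0) ∧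
        0 ≤ θ 0 ∧ (∀ s, S ≤ s → θ s = θ S) ∧ K ^ 2 ≤ S ∧
        (∀ s, s₀ ≤ s → s ≤ K ^ 2 → θ s = 4 * K * s / (4 * K + s)) ∧
        (∀ s, s₀ ≤ s → θ s ≤ 4 * K) ∧ (∀ s, K ^ 2 ≤ s → 4 * K * K ^ 2 / (4 * K + K ^ 2) ≤ θ s) ∧
        (∀ s, s₀ ≤ s → deriv θ s ≤ 16 * K ^ 2 / (4 * K + s) ^ 2) := by
  intro K s₀ hK hs₀ hsK
  obtain ⟨d, hd_smooth, hd_anti, hd_nn, hd_eq, hd_le, hd_zero, hd_bd⟩ := exists_slope hK hs₀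
  have hd_cont : Continuous d := hd_smooth.continuous
  have hint : ∀ a b, IntervalIntegrable d volume a b := fun a b ↦ hd_cont.intervalIntegrable a b
  set θ : ℝ → ℝ := fun s ↦ 4 * K * s₀ / (4 * K + s₀) + ∫ t in s₀..s, d t with hθ
  have hderiv : ∀ s, HasDerivAt θ (d s) s := fun s ↦ hasDerivAt_const_add_integral hd_cont _ _ s
  have hderiv_eq : deriv θ = d := funext fun s ↦ (hderiv s).deriv
  have hθ_mono : Monotone θ :=
    monotone_of_deriv_nonneg (fun s ↦ (hderiv s).differentiableAt) (by rw [hderiv_eq]; exact hd_nn)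
  have hdiff : ∀ a b, θ b = θ a + ∫ t in a..b, d t := fun a b ↦ const_add_integral_eq hd_cont _ _ a b
  have hexact : ∀ s, s₀ ≤ s → s ≤ K ^ 2 → θ s = 4 * K * s / (4 * K + s) := by
    intro s hs hsK'
    have h1 : ∫ t in s₀..s, d t = ∫ t in s₀..s, 16 * K ^ 2 / (4 * K + t) ^ 2 :=
      intervalIntegral.integral_congr fun t ht ↦ by
        rw [uIcc_of_le hs] at ht
        exact hd_eq t ht.1 (ht.2.trans hsK')
    show 4 * K * s₀ / (4 * K + s₀) + ∫ t in s₀..s, d t = _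
    rw [h1, integral_roundSlope hK hs₀ hs]
    ring
  refine ⟨θ, 2 * K ^ 2, contDiff_const_add_integral hd_smooth _ _, ?_, ?_, ?_, ?_,
    by nlinarith [sq_nonneg K], hexact, ?_, ?_, ?_⟩
  · intro s
    rw [hderiv_eq]
    exact hd_nn s
  · intro s
    rw [hderiv_eq]
    exact hd_anti.deriv_nonpos
  · have h1 : ∫ t in (0 : ℝ)..s₀, d t ≤ ∫ _ in (0 : ℝ)..s₀, 16 * K ^ 2 / (4 * K + s₀ / 2) ^ 2 :=
      intervalIntegral.integral_mono_on hs₀.le (hint _ _) intervalIntegrable_const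
        fun t _ ↦ hd_bd t
    rw [intervalIntegral.integral_const, smul_eq_mul, sub_zero] at h1
    have h2 : s₀ * (16 * K ^ 2 / (4 * K + s₀ / 2) ^ 2) ≤ 4 * K * s₀ / (4 * K + s₀) := by
      rw [mul_div_assoc', div_le_div_iff₀ (by positivity) (by positivity)]
      nlinarith [mul_pos hK (pow_pos hs₀ 3)]
    show 0 ≤ 4 * K * s₀ / (4 * K + s₀) + ∫ t in s₀..(0 : ℝ), d t
    rw [intervalIntegral.integral_symm]
    linarith
  · intro s hs
    rw [hdiff (2 * K ^ 2) s, intervalIntegral.integral_congr (g := fun _ ↦ (0 : ℝ))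
      fun t ht ↦ hd_zero t (by rw [uIcc_of_le hs] at ht; exact ht.1)]
    simp
  · intro s hs
    have h1 : ∫ t in s₀..s, d t ≤ ∫ t in s₀..s, 16 * K ^ 2 / (4 * K + t) ^ 2 :=
      intervalIntegral.integral_mono_on hs (hint _ _) (intervalIntegrable_roundSlope hK hs₀.le hs)
        fun t ht ↦ hd_le t ht.1
    rw [integral_roundSlope hK hs₀ hs] at h1
    have h2 : 4 * K * s / (4 * K + s) ≤ 4 * K := by
      rw [div_le_iff₀ (by linarith)]
      nlinarith [sq_nonneg K]
    show 4 * K * s₀ / (4 * K + s₀) + ∫ t in s₀..s, d t ≤ 4 * K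
    linarith
  · intro s hs
    rw [← hexact (K ^ 2) hsK.le le_rfl]
    exact hθ_mono hs
  · intro s hs
    rw [hderiv_eq]
    exact hd_le s hs

end Summit.SmoothPoincare4.SmoothPoincare4.Theorems

end
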